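import Literature.NumberTheory.Rogawski1990.UnitOrbitalIntegralInertValueTHFinal             -- ★ A-p03 p841959 (`|A − b₀| = |ϖ^{N₊}|`)
import Literature.NumberTheory.Rogawski1990.UnitOrbitalIntegralInertValueTHBoundary          -- ★∕pending B-p12 p842160 (`A = b₀`)
import Literature.NumberTheory.Rogawski1990.UnitOrbitalIntegralInertClosedFormsTypeTwoObservable   -- ★ B-p12 (P2) p841969
import Literature.NumberTheory.Automorphic.UnitaryThreeRamifiedTorusNormalForm              -- ★ B-p12 (d3) p842106
import Literature.NumberTheory.Automorphic.UnitaryThreeAnisotropicNormalFormExponents       -- ★ B-p14 (d2): conjugation invariance of `#Fix`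
import Literature.NumberTheory.Automorphic.UnitaryThreeRamifiedTorusWeightPrelims           -- ★ B-p12: `rtorus_v_facts`
import HarnessLib

/-!
# κ = +1 VALUE, LITERAL-FREE: `#{q ∈ U⧸K : t q = q} = phiTHn q n N` for ANY `t ∈ U(Φ₃)` with an eigenvector of even norm valuation and a type-(2) complementary factor
(Flicker (1998), Prop. 11 p. 87 ∕ proof of Theorem 18 p. 97: `Φ(t) = phiTH(N₂, N)`, `n = min(1+2N, 2+2N₂)`; Rogawski (1990) §4.9)

Topic `NumberTheory/Rogawski1990`; namespace `Literature.NumberTheory.Automorphic.UnitaryGroup`.  THEOREMS ONLY; kernel lane.  Cell `pub/hodgecm-mathlib`, road «N7-ns COUNT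
FROM FLICKER», line «N7nsCount», value stub `stub_irredGValuePos` (:1189, κ = +1): the `U(Φ₃)(K)`-level CLOSER (everything below the (P3) transport), assembling
(d3) ★ `exists_conj_coe_eq_ramifiedTorus` (conjugate `t` to the ramified-torus literal; `#Fix` is conjugation invariant, ★ B-p14 (d2) `natCard_fixedPoints_quotient_conj_eq`)
∘ `by_cases A = u` over {★ A-p03 p841959 `…_eq_phiTHM_final`, ★ B-p12 p842160 `…_final_of_eq`} ∘ the exponent link ★ `v_disc_and_v_eval_of_ramifiedTorus` ∘ ★ (P2)
`phiTHn_eq_phiTHM_of_eq_min`.  INPUT = `t` with `t x = u x`, `v(B₀(x,x))` EVEN (`κ = +1`), `v((tr t − u)² − 4 det t∕u) = |ϖ^{2N+1}|` (type (2)) and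
`v(u² − (tr t − u)u + det t∕u) = |ϖ^n|` (the OBSERVABLE `n = ord χ₂(u)`); OUTPUT = `phiTHn q n N`.  No literal, no `N₊`, no case distinction left for the stub's pen (p04 ∕
B-p14 lineage; architect A-p06 ED. 1.6): only the (P3) transport from `G′_v` and the reading of `κ_v = +1` as «even norm valuation of the `u`-eigenline» remain.
HONEST LABEL: HC_CM is proved only modulo the printed citations (2 remaining named inputs hLiu418, h413) until rung 0 closes.

## References
* [Flicker1998UnitaryFL] Y. Z. Flicker, *Elementary proof of the fundamental lemma for a unitary group*, Canad. J. Math. 50 (1998): Prop. 5 p. 82, Cor. 9 p. 85,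
  Prop. 10 p. 85, Prop. 11 p. 87, Theorem 18 p. 97.
* [Rogawski1990] J. D. Rogawski, *Automorphic Representations of Unitary Groups in Three Variables* (1990), §4.9 p. 55.
-/

set_option autoImplicit false

open scoped MatrixGroups WithZero Valued
open Matrix

universe u

namespace Literature.NumberTheory.Automorphic

namespace UnitaryGroup

open Literature.NumberTheory.Automorphic.HermitianLattice
open Literature.NumberTheory.Rogawski1990.Flicker1998 (phiTHM phiTHn phiTHn_eq_phiTHM_of_eq_min)
open IsLocalRing

variable {K : Type*} [Field K] [Valued K ℤᵐ⁰] {ϖ : K} (σ : K →+* K) {J : Matrix (Fin 3) (Fin 3) K}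

section THEigen

variable [IsDiscreteValuationRing 𝒪[K]] [Finite (ResidueField 𝒪[K])] [IsAdicComplete (maximalIdeal 𝒪[K]) 𝒪[K]]

/-- Square root in `ℤᵐ⁰`: `exp(−1)·c² = exp(−(2N+1))` with `c ≠ 0` forces `c = exp(−N)`. [cite: Flicker1998UnitaryFL, Theorem 18 p. 97] -/
private theorem eq_exp_neg_of_mul_sq_eq {c : ℤᵐ⁰} (hc : c ≠ 0) {N : ℕ}
    (h : WithZero.exp (-1 : ℤ) * c ^ 2 = WithZero.exp (-((2 * N + 1 : ℕ) : ℤ))) : c = WithZero.exp (-(N : ℤ)) := by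
  rw [← WithZero.exp_log hc, ← WithZero.exp_nsmul, ← WithZero.exp_add, WithZero.exp_inj, nsmul_eq_mul] at h
  rw [← WithZero.exp_log hc]
  congr 1
  push_cast at h
  omega

/-- `max` of two `exp`s, read on the exponents. [cite: Flicker1998UnitaryFL, Theorem 18 p. 97] -/
private theorem eq_min_of_exp_neg_eq_max {n a b : ℕ}
    (h : WithZero.exp (-(n : ℤ)) = max (WithZero.exp (-(a : ℤ))) (WithZero.exp (-(b : ℤ)))) : n = min a b := by
  rcases le_total (WithZero.exp (-(a : ℤ)) : ℤᵐ⁰) (WithZero.exp (-(b : ℤ))) with hab | hab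
  · rw [max_eq_right hab, WithZero.exp_inj] at h
    rw [WithZero.exp_le_exp] at hab
    omega
  · rw [max_eq_left hab, WithZero.exp_inj] at h
    rw [WithZero.exp_le_exp] at hab
    omega

set_option maxHeartbeats 800000 in
-- assembly through (d3), two ★ value heads and (P2); the frame terms are large
/-- **κ = +1 VALUE, LITERAL-FREE.**  For `t ∈ U(σ, Φ₃)(K)` with an eigenvector `x`, `t x = u x`, of EVEN norm valuation (`κ = +1`), complementary quadratic factor of
type (2) (`v((tr t − u)² − 4 det t∕u) = |ϖ^{2N+1}|`) and observable exponent `n` (`v(u² − (tr t − u)u + det t∕u) = |ϖ^n|`):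
**`#{q ∈ U⧸K : t q = q} = phiTHn q n N`** (Flicker's `Φ(t)` for the type-(2) torus, all strata incl. `tr t = 3u`), over the frame `(hσO, a₀, u_m, y)` and the lattice
bridge `(R, ι, σR, dR, ϖR)`. [cite: Flicker1998UnitaryFL, Prop. 11 p. 87; Theorem 18 p. 97] [cite: Rogawski1990, §4.9 Prop. 4.9.1 (b) p. 55] -/
theorem natCard_fixedPoints_unitaryInt_eq_phiTHn_of_eigen (hJ : J = (StdForm.antidiagonal 3).over K) (hd : LocalConjDatum σ ϖ)
    (hσO : ∀ y : 𝒪[K], (σ.comp 𝒪[K].subtype) y ∈ 𝒪[K]) {y : K} (hy : y * σ y = -2)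
    {c : ↥(unitaryGroupOfForm σ J)} (hc : ((c : GL (Fin 3) K) : Matrix (Fin 3) (Fin 3) K) = !![1, 0, 0; 0, -1, 0; 0, 0, 1])
    (um : ℕ → ↥(unitaryGroupOfForm σ J))
    (hum : ∀ m, ((um m : GL (Fin 3) K) : Matrix (Fin 3) (Fin 3) K) = !![ϖ ^ m, y, (ϖ ^ m)⁻¹; 0, 1, -σ y * (ϖ ^ m)⁻¹; 0, 0, (ϖ ^ m)⁻¹])
    {R : Type u} [CommRing R] [IsDomain R] [IsDiscreteValuationRing R] [IsAdicComplete (IsLocalRing.maximalIdeal R) R]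
    (ι : R →+* K) (hι : Function.Injective ι)
    (hιv : ∀ x : K, Valued.v x ≤ 1 ↔ x ∈ Set.range ι) (σR : R →+* R) (hσR : ∀ r, σR (σR r) = r) (hσι : ∀ r, ι (σR r) = σ (ι r))
    {dR : R} (hdRσ : σR dR = -dR) (hdRu : IsUnit dR) (h2R : IsUnit (2 : R)) {ϖR : R} (hϖR : Irreducible ϖR) (hιϖ : ι ϖR = ϖ)
    {q : ℕ} (hq : Nat.card (ResidueField 𝒪[K]) = q ^ 2) (hqR : Nat.card (ResidueField R) = q ^ 2) (hq1 : 1 < q)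
    {a₀ : 𝒪[K]} (ha₀ : IsUnit (((σ.comp 𝒪[K].subtype).codRestrict 𝒪[K] hσO) a₀ - a₀))
    {t : ↥(unitaryGroupOfForm σ J)} {x : Fin 3 → K} {u : K} (htx : (((t : ↥(unitaryGroupOfForm σ J)) : GL (Fin 3) K) : Matrix (Fin 3) (Fin 3) K) *ᵥ x = u • x) {k : ℤ} (hx : Valued.v (B₀ σ 3 x x) = WithZero.exp (2 * k))
    {N n : ℕ} (hN : Valued.v ((Matrix.trace (((t : ↥(unitaryGroupOfForm σ J)) : GL (Fin 3) K) : Matrix (Fin 3) (Fin 3) K) - u) ^ 2 - 4 * (Matrix.det (((t : ↥(unitaryGroupOfForm σ J)) : GL (Fin 3) K) : Matrix (Fin 3) (Fin 3) K) / u)) = Valued.v (ϖ ^ (2 * N + 1)))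
    (hn : Valued.v (u ^ 2 - (Matrix.trace (((t : ↥(unitaryGroupOfForm σ J)) : GL (Fin 3) K) : Matrix (Fin 3) (Fin 3) K) - u) * u + Matrix.det (((t : ↥(unitaryGroupOfForm σ J)) : GL (Fin 3) K) : Matrix (Fin 3) (Fin 3) K) / u) = Valued.v (ϖ ^ n))
    (hfin : {z : ↥(unitaryGroupOfForm σ J) ⧸ unitaryInt σ J | t • z = z}.Finite) :
    (Nat.card {z : ↥(unitaryGroupOfForm σ J) ⧸ unitaryInt σ J | t • z = z} : ℚ) = phiTHn q n N := by
  have hϖ0 : ϖ ≠ 0 := hd.ϖ_ne_zero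
  have hvpow : ∀ j : ℕ, Valued.v (ϖ ^ j) = WithZero.exp (-(j : ℤ)) := fun j => by
    rw [map_pow, hd.vϖ, ← WithZero.exp_nsmul, nsmul_eq_mul, mul_neg, mul_one]
  -- (d3): conjugate to the literal
  obtain ⟨m, hm⟩ : ∃ m : ℤ, Valued.v ((Matrix.trace (((t : ↥(unitaryGroupOfForm σ J)) : GL (Fin 3) K) : Matrix (Fin 3) (Fin 3) K) - u) ^ 2 - 4 * (Matrix.det (((t : ↥(unitaryGroupOfForm σ J)) : GL (Fin 3) K) : Matrix (Fin 3) (Fin 3) K) / u)) = WithZero.exp (2 * m + 1) :=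
    ⟨-(N : ℤ) - 1, by rw [hN, hvpow]; congr 1; push_cast; ring⟩
  obtain ⟨g, A, C, ρ, hlit, hC0, hvρ, hσρ, hu, htr, hdet⟩ := exists_conj_coe_eq_ramifiedTorus σ hJ hd hσO ha₀ htx hx hm
  have hu0 : u ≠ 0 := fun h0 => by rw [h0, mul_zero] at hu; exact zero_ne_one hu
  set t' : ↥(unitaryGroupOfForm σ J) := g⁻¹ * t * g with ht'
  have ht'H : t' ∈ Subgroup.centralizer ({c} : Set ↥(unitaryGroupOfForm σ J)) := mem_centralizer_of_coe_eq_block σ hc hlit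
  -- conjugation invariance of the count and of finiteness (★ (d2))
  have hcount : Nat.card {z : ↥(unitaryGroupOfForm σ J) ⧸ unitaryInt σ J | t' • z = z} = Nat.card {z : ↥(unitaryGroupOfForm σ J) ⧸ unitaryInt σ J | t • z = z} :=
    natCard_fixedPoints_quotient_conj_eq σ (unitaryInt σ J) g t
  have hfin' : {z : ↥(unitaryGroupOfForm σ J) ⧸ unitaryInt σ J | t' • z = z}.Finite := (finite_fixedPoints_quotient_conj_iff σ (unitaryInt σ J) g t).2 hfin
  rw [← hcount]
  -- the representatives `r` (★ `exists_ramifiedRep`) with `d = ι dR`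
  have hvd : Valued.v (ι dR) = 1 := TorusBridge.v_eq_one_of_isUnit ι hιv hdRu
  have hdK : σ (ι dR) = -(ι dR) := by rw [← hσι, hdRσ, map_neg]
  have hd0 : ι dR ≠ 0 := fun h0 => by rw [h0, map_zero] at hvd; exact zero_ne_one hvd
  obtain ⟨r, hr0, hr1⟩ := exists_ramifiedRep σ hJ hd.σϖ hϖ0 hdK hd0 hc
  -- exponents: `|C| = |ϖ^N|`, `|χ₂(u)| = max(|u − A|², |ϖ|·|C|²)`
  obtain ⟨hvdisc, hveval⟩ := v_disc_and_v_eval_of_ramifiedTorus σ hd hu0 hvρ htr hdet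
  have hvC0 : Valued.v C ≠ 0 := (Valuation.ne_zero_iff _).2 hC0
  have hvC : Valued.v C = Valued.v (ϖ ^ N) := by
    rw [hvpow]
    refine eq_exp_neg_of_mul_sq_eq hvC0 ?_
    rw [← hd.vϖ, ← hvdisc, hN, hvpow]
  have hBC : C * ρ = C * ρ := rfl
  -- `|A| = 1 = |u|`
  have hlit' : (((t' : ↥(unitaryGroupOfForm σ J)) : GL (Fin 3) K) : Matrix (Fin 3) (Fin 3) K) = !![A, 0, ρ * C; 0, u, 0; C, 0, A] := by rw [ht', hlit, mul_comm C ρ]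
  obtain ⟨hvA, -, -, -, -⟩ := rtorus_v_facts σ hJ hd hdK hd0 hvρ hlit'
  have hvu : Valued.v u = 1 := by
    have h1 := congrArg Valued.v hu
    rw [map_mul, hd.vσ, map_one] at h1
    exact Literature.NumberTheory.QuadraticForms.OMeara65.WithZeroMulInt.eq_one_of_mul_self h1
  by_cases hAb : A = u
  · -- boundary `tr t = 3u`: value `phiTHM q (N+1) N = phiTHn q (2N+1) N`
    have hval := natCard_fixedPoints_unitaryInt_ramifiedTorus_eq_phiTHM_final_of_eq σ hJ hd hσO hy hc um hum ι hι hιv σR hσR hσι hdRσ hdRu h2R hϖR hιϖ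
      hvρ hlit ht'H hBC r hr0 hr1 hvC hAb hq hqR hq1 ha₀ hfin'
    have hn' : n = 2 * N + 1 := by
      rw [hAb, sub_self, map_zero, zero_pow two_ne_zero, ← hvdisc, hN, hvpow, hn, hvpow, max_eq_right zero_le, WithZero.exp_inj] at hveval
      omega
    rw [hval, phiTHn_eq_phiTHM_of_eq_min (Np := N + 1) (by rw [hn']; exact (min_eq_left (by omega)).symm)]
  · -- generic `A ≠ u`: `|A − u| = |ϖ^{N₊}|`, value `phiTHM q N₊ N = phiTHn q (min(2N₊, 2N+1)) N`
    have hAu0 : Valued.v (A - u) ≠ 0 := (Valuation.ne_zero_iff _).2 (sub_ne_zero.2 hAb)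
    have hAu1 : Valued.v (A - u) ≤ 1 := by
      refine (Valuation.map_sub _ _ _).trans ?_
      rw [hvA, hvu, max_self]
    obtain ⟨Np, hNp⟩ : ∃ Np : ℕ, Valued.v (A - u) = Valued.v (ϖ ^ Np) := by
      have h0 : WithZero.log (Valued.v (A - u)) ≤ 0 := by
        rw [← WithZero.exp_log hAu0, ← WithZero.exp_zero, WithZero.exp_le_exp] at hAu1; exact hAu1
      refine ⟨(-WithZero.log (Valued.v (A - u))).toNat, ?_⟩
      rw [hvpow, Int.toNat_of_nonneg (by omega : (0 : ℤ) ≤ -WithZero.log (Valued.v (A - u))), neg_neg]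
      exact (WithZero.exp_log hAu0).symm
    have hval := natCard_fixedPoints_unitaryInt_ramifiedTorus_eq_phiTHM_final σ hJ hd hσO hy hc um hum ι hι hιv σR hσR hσι hdRσ hdRu h2R hϖR hιϖ
      hvρ hσρ hlit ht'H hBC r hr0 hr1 hvC hNp hq hqR hq1 ha₀ hfin'
    have hn' : n = min (2 * N + 1) (2 * Np) := by
      rw [Valuation.map_sub_swap, hNp, ← hvdisc, hN, hvpow, hvpow, hn, hvpow, ← WithZero.exp_nsmul, nsmul_eq_mul] at hveval
      have h' : WithZero.exp (-(n : ℤ)) = max (WithZero.exp (-((2 * Np : ℕ) : ℤ))) (WithZero.exp (-((2 * N + 1 : ℕ) : ℤ))) := by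
        rw [hveval]; congr 2; push_cast; ring
      have := eq_min_of_exp_neg_eq_max h'
      omega
    rw [hval, phiTHn_eq_phiTHM_of_eq_min hn']

end THEigen

end UnitaryGroup

end Literature.NumberTheory.Automorphic
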